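import Literature.Barriers.CriticalPhenomena.LaceExpansionHaraLemma41
import Literature.Barriers.CriticalPhenomena.LaceExpansionCubeSliceIntegrals
import Literature.Barriers.CriticalPhenomena.LaceExpansionXSpaceNorms
import HarnessLib

/-!
# Hara 2008, Lemma 1.7 for `Ḡ^{(α)}` with integer exponents: `sup_x |x|^m G(x) < ∞`, proved

Barrier catalogue `Literature/Barriers/CriticalPhenomena/` (D-0021). The named fact
`Hara2008_lemma17Pc` (`LaceExpansionXSpaceNorms.lean`; Hara 2008, Lemma 1.7 — the analytic input of the
`x`-space half `Hara2008_xSpacePiBoundPc`) asserts among other things: if `Σ_x |x|^φ |Π(x)| < ∞`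
then `Ḡ^{(α)} = sup_a |a|^α G(a) < ∞` for `α ≤ φ`, `α < d - 2` (`α` not an odd integer). Hara proves
the even-integer case in §4.1.2: `G_j^{(2n)}(x) = |x_j|^{2n} G(x) = (-1)^n ∫ e^{ikx} ∂_j^{2n}Ĝ(k)
d^dk/(2π)^d` ((4.8)), "`G_j^{(α)}(a) ≤ ∫ |Ĝ_j^{(α)}| ≤ ∫ c/|k|^{2+α}`, which is finite for `2 + α < d`"
((4.9)), using Lemma 4.1. This file PROVES that case — for ALL integers `m` (odd ones included:
`|x_j|^m G = |x_j^m G|` and `x_j^m G` has transform `(i∂_j)^m Ĝ`) — at `p = p_c` for an abstract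
lace-expansion coefficient `Φ` (`IsLaceCoefficientPc d Φ`) with `Σ_x (1+|x|)^M |Π(x)| < ∞`:

* `norm_integral_haraIntegrand_mul_pow_le` — the kernel/source form: under the hypotheses of
  Lemma 4.1 (`LaceExpansionHaraLemma41.lean`), for `m ≤ M`, `m + 3 ≤ d`,
  `‖∫_{[-π,π]^d} e^{ik·y} Ĝ(k) dk‖ · |y_l|^m ≤ C` uniformly in `y ∈ ℤ^d`. Since `Ĝ` is singular at
  `k = 0`, the integration by parts of (4.8) is done slice-wise (`LaceExpansionCubeSliceIntegrals.lean`):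
  Fubini in the coordinate `l`, the iterated periodic integration by parts on each slice
  `s ↦ Ĝ(ins_l(s,k'))` (`k' ≠ 0`, a.e.), the bound `‖∂_l^m Ĝ‖ ≤ C/|k|^{2+m}` of Lemma 4.1, and
  `∫ |k|^{-2-m} < ∞`;
* `IsLaceCoefficientPc.exists_abs_pow_mul_tau_le`, `…exists_pow_mul_tau_le` — at `p_c`:
  `|y_l|^m τ_{p_c}(0,y) ≤ C`, `|y|^m τ_{p_c}(0,y) ≤ C` for `m ≤ M`, `m + 3 ≤ d`;
* `IsLaceCoefficientPc.haraGBar_lt_top_of_moment` / `…_of_rpow` — **Lemma 1.7 (G), integer case**: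
  `Ḡ^{(α)} < ∞` for every real `α` with `⌈α⌉ ≤ M` (resp. `⌈α⌉ ≤ ⌊φ⌋` under
  `Σ_x |x|^φ|Π(x)| < ∞`, `φ ≥ 2`) and `⌈α⌉ < d - 2` (non-integer `α` below `⌊φ⌋` are free from the
  integer case since `|y|^α ≤ |y|^{⌈α⌉}` on `ℤ^d ∖ {0}`, cf. Hara's §4.1.3).

Not here (the remaining cases of the `Ḡ`-clause of Lemma 1.7): non-integer `α` with
`⌊φ⌋ < α ≤ φ` or `d - 3 < α < d - 2` (Hara's §4.1.4 and §4.3–§4.4, fractional derivatives).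

## References

* T. Hara, Ann. Probab. 36 (2008) 530–593 (arXiv:math-ph/0504021): Lemma 1.7 (§1.2.4), §4.1.1–§4.1.2
  ((4.3), (4.8), (4.9)), Lemma 4.1.
-/

noncomputable section

namespace Literature.Barriers.CriticalPhenomena

open _root_.MeasureTheory Filter Finset Literature.Probability.LatticeModels
  Literature.Probability.Percolation
open scoped Topology BigOperators ENNReal

/-! ### The slices `s ↦ Ĝ(ins_l(s,k'))` of `Ĝ = ĝ/(1 - Ĵ)` -/

section Slices

variable {n : ℕ}

/-- Along a slice, `ins_l(s,k') = k₀[l ↦ s]` with `k₀ = ins_l(0,k')`. [folklore] -/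
theorem insertNth_eq_update_insertNth_zero (l : Fin (n + 1)) (s : ℝ) (k' : Fin n → ℝ) :
    (l.insertNth s k' : Fin (n + 1) → ℝ) = Function.update (l.insertNth 0 k') l s :=
  (update_insertNth_eq l 0 s k').symm

/-- The slice `s ↦ F(ins_l(s,k'))` and Hara's `∂_l^m`: `∂_l^m F(ins_l(s,k')) = (d/ds)^m F(ins_l(s,k'))`.
[folklore] -/
theorem sliceDeriv_insertNth (F : (Fin (n + 1) → ℝ) → ℂ) (l : Fin (n + 1)) (m : ℕ) (s : ℝ)
    (k' : Fin n → ℝ) :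
    sliceDeriv F l m (l.insertNth s k') = iteratedDeriv m (fun s : ℝ => F (l.insertNth s k')) s := by
  unfold sliceDeriv
  simp only [update_insertNth_eq, Fin.insertNth_apply_same]

variable {J g : Site (n + 1) → ℝ} {M : ℕ}

/-- **Regularity of the slices of `Ĝ`.** Under the hypotheses of Lemma 4.1, for a transverse
momentum `k' ∈ [-π,π]^n ∖ {0}` the slice `s ↦ Ĝ(ins_l(s,k'))` is `C^M` on `ℝ` and `2π`-periodic
(the denominator `1 - Ĵ` does not vanish on the slice: reduce `s` modulo `2π` into the cube, where
`|1 - Ĵ| ≥ c₀|k|² > 0`). [cite: Hara2008, Lemma 4.1 and §4.1.2 ((4.8))] -/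
theorem contDiff_kspaceTwoPoint_insertNth
    (hJ : Summable fun x => (1 + euclidNorm x) ^ M * |J x|)
    (hg : Summable fun x => (1 + euclidNorm x) ^ M * |g x|)
    {c₀ : ℝ} (hc₀ : 0 < c₀) (hlow : ∀ k ∈ cube (n + 1), c₀ * knorm k ^ 2 ≤ ‖1 - latticeFT J k‖)
    (l : Fin (n + 1)) {k' : Fin n → ℝ} (hk' : k' ∈ cube n) (hk'0 : k' ≠ 0) :
    ContDiff ℝ M (fun s : ℝ => kspaceTwoPoint J g (l.insertNth s k')) ∧
      Function.Periodic (fun s : ℝ => kspaceTwoPoint J g (l.insertNth s k')) (2 * Real.pi) := by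
  set k₀ : Fin (n + 1) → ℝ := l.insertNth 0 k' with hk₀
  set u : ℝ → ℂ := fun s => latticeFT g (Function.update k₀ l s) with hu_def
  set v : ℝ → ℂ := fun s => 1 - latticeFT J (Function.update k₀ l s) with hv_def
  have hu : ContDiff ℝ M u := contDiff_latticeFT_update hg k₀ l
  have hv : ContDiff ℝ M v := contDiff_const.sub (contDiff_latticeFT_update hJ k₀ l)
  have huper : Function.Periodic u (2 * Real.pi) := fun s => by
    simp only [hu_def]
    rw [latticeFT_update_add_two_pi]
  have hvper : Function.Periodic v (2 * Real.pi) := fun s => by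
    simp only [hv_def]
    rw [latticeFT_update_add_two_pi]
  have hv0 : ∀ s, v s ≠ 0 := by
    intro s
    obtain ⟨s', hs', hvs⟩ := hvper.exists_mem_Ico Real.two_pi_pos s (-Real.pi)
    rw [hvs]
    have hmem : Function.update k₀ l s' ∈ cube (n + 1) := by
      rw [hk₀, ← insertNth_eq_update_insertNth_zero]
      refine (insertNth_mem_cube_iff l s' k').2 ⟨⟨hs'.1, ?_⟩, hk'⟩
      linarith [hs'.2]
    have hne : Function.update k₀ l s' ≠ 0 := by
      rw [hk₀, ← insertNth_eq_update_insertNth_zero]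
      exact insertNth_ne_zero_of_ne_zero l s' hk'0
    have hpos : 0 < ‖v s'‖ := by
      have h1 := hlow _ hmem
      have h2 : 0 < c₀ * knorm (Function.update k₀ l s') ^ 2 :=
        mul_pos hc₀ (pow_pos (knorm_pos_of_ne_zero hne) 2)
      simp only [hv_def]
      linarith
    exact norm_pos_iff.1 hpos
  have hFeq : (fun s : ℝ => kspaceTwoPoint J g (l.insertNth s k')) = fun s => u s * (v s)⁻¹ := by
    funext s
    simp only [hu_def, hv_def, kspaceTwoPoint, hk₀, ← insertNth_eq_update_insertNth_zero]
    rw [div_eq_mul_inv]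
  rw [hFeq]
  refine ⟨hu.mul (hv.inv hv0), fun s => ?_⟩
  simp only []
  rw [huper s, hvper s]

/-- **The derivative bound on a slice**: with `C` from Lemma 4.1 (`‖∂_l^m Ĝ(k)‖ ≤ C/|k|^{2+m}` on the
punctured cube), `‖(d/ds)^m Ĝ(ins_l(s,k'))‖ ≤ C/|ins_l(s,k')|^{2+m}` for `s ∈ [-π,π]`,
`k' ∈ [-π,π]^n ∖ {0}`. [cite: Hara2008, Lemma 4.1 ((4.7))] -/
theorem norm_iteratedDeriv_slice_le {C : ℝ} {l : Fin (n + 1)} {m : ℕ}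
    (hC : ∀ k ∈ cube (n + 1), k ≠ 0 → ‖sliceDeriv (kspaceTwoPoint J g) l m k‖ ≤ C / knorm k ^ (2 + m))
    {k' : Fin n → ℝ} (hk' : k' ∈ cube n) (hk'0 : k' ≠ 0) {s : ℝ} (hs : s ∈ Set.Icc (-Real.pi) Real.pi) :
    ‖iteratedDeriv m (fun s : ℝ => kspaceTwoPoint J g (l.insertNth s k')) s‖ ≤
      C / knorm (l.insertNth s k' : Fin (n + 1) → ℝ) ^ (2 + m) := by
  rw [← sliceDeriv_insertNth]
  exact hC _ ((insertNth_mem_cube_iff l s k').2 ⟨hs, hk'⟩) (insertNth_ne_zero_of_ne_zero l s hk'0)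

/-- The bounding function `s ↦ C/|ins_l(s,k')|^q` is continuous when `k' ≠ 0`. [folklore] -/
theorem continuous_div_knorm_insertNth_pow (C : ℝ) (l : Fin (n + 1)) (q : ℕ) {k' : Fin n → ℝ}
    (hk'0 : k' ≠ 0) :
    Continuous fun s : ℝ => C / knorm (l.insertNth s k' : Fin (n + 1) → ℝ) ^ q := by
  have hins : Continuous fun s : ℝ => (l.insertNth s k' : Fin (n + 1) → ℝ) :=
    Continuous.finInsertNth l continuous_id continuous_const
  have hk : Continuous fun s : ℝ => knorm (l.insertNth s k' : Fin (n + 1) → ℝ) := by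
    unfold knorm
    refine Real.continuous_sqrt.comp ?_
    refine continuous_finsetSum _ fun i _ => ?_
    exact ((continuous_apply i).comp hins).pow 2
  refine continuous_const.div (hk.pow q) fun s => ?_
  exact pow_ne_zero q (knorm_pos_of_ne_zero (insertNth_ne_zero_of_ne_zero l s hk'0)).ne'

/-- **The slice estimate.** For `k' ∈ [-π,π]^n ∖ {0}` and `y ∈ ℤ^{n+1}`: with `F(s) = Ĝ(ins_l(s,k'))`,
`|y_l|^m ‖∫_{-π}^{π} e^{isy_l} F(s) ds‖ = ‖∫ e^{isy_l} F^{(m)}‖ ≤ ∫_{-π}^{π} C/|ins_l(s,k')|^{2+m} ds`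
(iterated periodic integration by parts and Lemma 4.1). [cite: Hara2008, §4.1.2 ((4.8)–(4.9))] -/
theorem abs_pow_mul_norm_sliceIntegral_le
    (hJ : Summable fun x => (1 + euclidNorm x) ^ M * |J x|)
    (hg : Summable fun x => (1 + euclidNorm x) ^ M * |g x|)
    {c₀ : ℝ} (hc₀ : 0 < c₀) (hlow : ∀ k ∈ cube (n + 1), c₀ * knorm k ^ 2 ≤ ‖1 - latticeFT J k‖)
    (l : Fin (n + 1)) {m : ℕ} (hm : m ≤ M) {C : ℝ}
    (hC : ∀ k ∈ cube (n + 1), k ≠ 0 → ‖sliceDeriv (kspaceTwoPoint J g) l m k‖ ≤ C / knorm k ^ (2 + m))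
    {k' : Fin n → ℝ} (hk' : k' ∈ cube n) (hk'0 : k' ≠ 0) (y : Site (n + 1)) :
    |((y l : ℤ) : ℝ)| ^ m *
        ‖∫ s in Set.Icc (-Real.pi) Real.pi, Complex.exp (Complex.I * ((s : ℂ) * (y l : ℂ))) *
          kspaceTwoPoint J g (l.insertNth s k')‖ ≤
      ∫ s in Set.Icc (-Real.pi) Real.pi, C / knorm (l.insertNth s k' : Fin (n + 1) → ℝ) ^ (2 + m) := by
  obtain ⟨hF, hper⟩ := contDiff_kspaceTwoPoint_insertNth hJ hg hc₀ hlow l hk' hk'0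
  set F : ℝ → ℂ := fun s => kspaceTwoPoint J g (l.insertNth s k') with hF_def
  have hπ : -Real.pi ≤ Real.pi := by linarith [Real.pi_pos]
  have hFm : ContDiff ℝ m F := hF.of_le (by exact_mod_cast hm)
  have hibp := intervalIntegral_cexp_mul_iteratedDeriv_eq hFm hper (y l)
  -- norms of the character and of `(-iy_l)^m`
  have hchar : ∀ s : ℝ, ‖Complex.exp (Complex.I * ((s : ℂ) * (y l : ℂ)))‖ = 1 := by
    intro s
    rw [show Complex.I * ((s : ℂ) * (y l : ℂ)) = ((s * (y l : ℝ) : ℝ) : ℂ) * Complex.I by push_cast; ring,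
      Complex.norm_exp_ofReal_mul_I]
  have hpow : ‖(-(Complex.I * (y l : ℂ))) ^ m‖ = |((y l : ℤ) : ℝ)| ^ m := by
    rw [norm_pow, norm_neg, norm_mul, Complex.norm_I, one_mul, Complex.norm_intCast]
  -- pass to interval integrals
  rw [integral_Icc_eq_integral_Ioc, ← intervalIntegral.integral_of_le hπ,
    integral_Icc_eq_integral_Ioc, ← intervalIntegral.integral_of_le hπ]
  have hcont_m : Continuous (iteratedDeriv m F) := hFm.continuous_iteratedDeriv m le_rfl
  have hbd : ∀ s ∈ Set.Icc (-Real.pi) Real.pi,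
      ‖Complex.exp (Complex.I * ((s : ℂ) * (y l : ℂ))) * iteratedDeriv m F s‖ ≤
        C / knorm (l.insertNth s k' : Fin (n + 1) → ℝ) ^ (2 + m) := by
    intro s hs
    rw [norm_mul, hchar s, one_mul]
    exact norm_iteratedDeriv_slice_le hC hk' hk'0 hs
  calc |((y l : ℤ) : ℝ)| ^ m *
        ‖∫ s in (-Real.pi)..Real.pi, Complex.exp (Complex.I * ((s : ℂ) * (y l : ℂ))) * F s‖
      = ‖∫ s in (-Real.pi)..Real.pi,
          Complex.exp (Complex.I * ((s : ℂ) * (y l : ℂ))) * iteratedDeriv m F s‖ := by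
        rw [hibp, norm_mul, hpow]
    _ ≤ ∫ s in (-Real.pi)..Real.pi,
          ‖Complex.exp (Complex.I * ((s : ℂ) * (y l : ℂ))) * iteratedDeriv m F s‖ :=
        intervalIntegral.norm_integral_le_integral_norm hπ
    _ ≤ ∫ s in (-Real.pi)..Real.pi, C / knorm (l.insertNth s k' : Fin (n + 1) → ℝ) ^ (2 + m) := by
        refine intervalIntegral.integral_mono_on hπ ?_ ?_ hbd
        · have hce : Continuous fun s : ℝ => Complex.exp (Complex.I * ((s : ℂ) * (y l : ℂ))) := by
            fun_prop
          exact ((hce.mul hcont_m).norm).intervalIntegrable _ _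
        · exact (continuous_div_knorm_insertNth_pow C l (2 + m) hk'0).intervalIntegrable _ _

end Slices

/-! ### The bound `‖∫ e^{ik·y} Ĝ(k) dk‖ · |y_l|^m ≤ C`, kernel/source form -/

/-- **`|y_l|^m |∫_{[-π,π]^d} e^{ik·y} Ĝ(k) dk| ≤ C`, uniformly in `y ∈ ℤ^d`** (kernel/source form).
Under the hypotheses of Lemma 4.1 — `Σ_x (1+|x|)^M (|J| + |g|) < ∞`, `M ≥ 2`, `J` `ℤ^d`-symmetric,
`c₀|k|² ≤ |1 - Ĵ(k)|` on the cube — and for `m ≤ M`, `m + 3 ≤ d`: there is `C` such that for every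
`y` for which `e^{ik·y}Ĝ(k)` is integrable on the cube, `‖∫ e^{ik·y} Ĝ‖ · |y_l|^m ≤ C`. This is
Hara's (4.8)–(4.9) "`G_j^{(α)}(a) ≤ ∫ |Ĝ_j^{(α)}(k)| ≤ ∫ c/|k|^{2+α}`, finite for `2 + α < d`", with
the integration by parts performed slice-wise in the coordinate `l`.
[cite: Hara2008, §4.1.2 ((4.8)–(4.9)) and Lemma 4.1] -/
theorem norm_integral_haraIntegrand_mul_pow_le {n : ℕ} {J g : Site (n + 1) → ℝ} {M : ℕ}
    (hM2 : 2 ≤ M) (hJ : Summable fun x => (1 + euclidNorm x) ^ M * |J x|)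
    (hg : Summable fun x => (1 + euclidNorm x) ^ M * |g x|) (hJs : IsZdSymmetric J)
    {c₀ : ℝ} (hc₀ : 0 < c₀) (hlow : ∀ k ∈ cube (n + 1), c₀ * knorm k ^ 2 ≤ ‖1 - latticeFT J k‖)
    (l : Fin (n + 1)) {m : ℕ} (hm : m ≤ M) (hmd : m + 3 ≤ n + 1) :
    ∃ C : ℝ, ∀ y : Site (n + 1), IntegrableOn (haraIntegrand J g y) (cube (n + 1)) →
      ‖∫ k in cube (n + 1), haraIntegrand J g y k‖ * |((y l : ℤ) : ℝ)| ^ m ≤ C := by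
  obtain ⟨C, hC⟩ := norm_sliceDeriv_kspaceTwoPoint_le hM2 hJ hg hJs hc₀ hlow l hm
  -- the bounding function and its slices
  set Ψ : (Fin (n + 1) → ℝ) → ℝ := fun k => C / knorm k ^ (2 + m) with hΨ_def
  have hΨi : IntegrableOn Ψ (cube (n + 1)) := by
    have h : IntegrableOn (fun k : Fin (n + 1) → ℝ => C * (1 / knorm k ^ (2 + m))) (cube (n + 1)) :=
      (integrableOn_one_div_knorm_pow (d := n + 1) (by omega) (q := 2 + m) (by omega)).const_mul C
    refine IntegrableOn.congr_fun h (fun k _ => ?_) (measurableSet_cube (n + 1))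
    simp only [hΨ_def]
    ring
  set Bnd : (Fin n → ℝ) → ℝ := fun k' => ∫ s in Set.Icc (-Real.pi) Real.pi, Ψ (l.insertNth s k')
    with hBnd_def
  have hBnd_int : IntegrableOn Bnd (cube n) := integrableOn_integral_slice l hΨi
  have hBnd_eq : ∫ k' in cube n, Bnd k' = ∫ k in cube (n + 1), Ψ k :=
    (integral_cube_succ_eq_iterated_of_integrable l hΨi).symm
  refine ⟨∫ k in cube (n + 1), Ψ k, fun y hHy => ?_⟩
  have hn1 : 1 ≤ n := by omega
  -- the inner integral on a slice
  set yt : Site n := fun j => y (l.succAbove j) with hyt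
  have hinner : ∀ k' : Fin n → ℝ,
      ∫ s in Set.Icc (-Real.pi) Real.pi, haraIntegrand J g y (l.insertNth s k') =
        Complex.exp (Complex.I * (kdot k' yt : ℂ)) *
          ∫ s in Set.Icc (-Real.pi) Real.pi, Complex.exp (Complex.I * ((s : ℂ) * (y l : ℂ))) *
            kspaceTwoPoint J g (l.insertNth s k') := by
    intro k'
    rw [← integral_const_mul]
    refine setIntegral_congr_fun measurableSet_Icc fun s _ => ?_
    simp only [haraIntegrand, kspaceTwoPoint, kdot_insertNth, hyt]
    push_cast
    rw [show Complex.I * ((s : ℂ) * ((y l : ℤ) : ℂ) + (kdot k' (fun j => y (l.succAbove j)) : ℂ)) =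
        Complex.I * (kdot k' (fun j => y (l.succAbove j)) : ℂ) + Complex.I * ((s : ℂ) * ((y l : ℤ) : ℂ))
        by ring, Complex.exp_add]
    ring
  have hkey : ∀ k' ∈ cube n, k' ≠ 0 →
      ‖∫ s in Set.Icc (-Real.pi) Real.pi, haraIntegrand J g y (l.insertNth s k')‖ *
        |((y l : ℤ) : ℝ)| ^ m ≤ Bnd k' := by
    intro k' hk' hk'0
    rw [hinner k', norm_mul, norm_cexp_I_mul_kdot, one_mul, mul_comm]
    exact abs_pow_mul_norm_sliceIntegral_le hJ hg hc₀ hlow l hm hC hk' hk'0 y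
  -- Fubini and monotonicity of the integral
  rw [integral_cube_succ_eq_iterated_of_integrable l hHy]
  calc ‖∫ k' in cube n, ∫ s in Set.Icc (-Real.pi) Real.pi, haraIntegrand J g y (l.insertNth s k')‖ *
        |((y l : ℤ) : ℝ)| ^ m
      ≤ (∫ k' in cube n, ‖∫ s in Set.Icc (-Real.pi) Real.pi, haraIntegrand J g y (l.insertNth s k')‖) *
          |((y l : ℤ) : ℝ)| ^ m :=
        mul_le_mul_of_nonneg_right (norm_integral_le_integral_norm _) (by positivity)
    _ = ∫ k' in cube n, ‖∫ s in Set.Icc (-Real.pi) Real.pi, haraIntegrand J g y (l.insertNth s k')‖ *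
          |((y l : ℤ) : ℝ)| ^ m := (integral_mul_const _ _).symm
    _ ≤ ∫ k' in cube n, Bnd k' := by
        refine integral_mono_of_nonneg (Eventually.of_forall fun k' => by positivity) hBnd_int ?_
        filter_upwards [ae_restrict_mem (measurableSet_cube n), ae_restrict_cube_ne_zero hn1]
          with k' hk' hk'0
        exact hkey k' hk' hk'0
    _ = ∫ k in cube (n + 1), Ψ k := hBnd_eq

/-! ### At `p = p_c`: `|y|^m τ_{p_c}(0,y)` is bounded, `Ḡ^{(m)} < ∞` -/

variable {d : ℕ}

/-- **`|y_l|^m τ_{p_c}(0,y) ≤ C`** for a lace-expansion coefficient with `Σ_x (1+|x|)^M |Π(x)| < ∞`,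
`M ≥ 2`, `m ≤ M`, `m + 3 ≤ d`: the representation `(2π)^d τ_{p_c}(0,y) = ∫ e^{ik·y} Ĝ(k) dk` and the
previous bound. [cite: Hara2008, Lemma 1.7 (Ḡ^{(α)} < ∞ for α ≤ φ, α < d - 2) and §4.1.2 ((4.8)–(4.9))] -/
theorem IsLaceCoefficientPc.exists_abs_pow_mul_tau_le {Φ : Site d → ℝ} (h : IsLaceCoefficientPc d Φ)
    {M : ℕ} (hM2 : 2 ≤ M) (hmom : Summable fun x => (1 + euclidNorm x) ^ M * |Φ x|) {m : ℕ}
    (hm : m ≤ M) (hmd : m + 3 ≤ d) (l : Fin d) :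
    ∃ C : ℝ, ∀ y : Site d, |((y l : ℤ) : ℝ)| ^ m * tau d (criticalProbI d) 0 y ≤ C := by
  obtain ⟨n, rfl⟩ : ∃ n, d = n + 1 := ⟨d - 1, by omega⟩
  obtain ⟨c₀, hc₀, hlow⟩ := h.exists_knorm_sq_le_norm
  obtain ⟨C, hC⟩ := norm_integral_haraIntegrand_mul_pow_le hM2 (summable_moment_laceKernel hmom _)
    (summable_moment_laceSource hmom) (isZdSymmetric_laceKernel h.symm _) hc₀ hlow l hm hmd
  refine ⟨C / (2 * Real.pi) ^ (n + 1), fun y => ?_⟩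
  have hy := hC y (h.integrableOn (by omega) y)
  rw [h.integral_eq y, norm_mul, Complex.norm_real, Real.norm_eq_abs,
    abs_of_nonneg (tau_nonneg _ _ _)] at hy
  have h2π : ‖((2 * Real.pi : ℂ) ^ (n + 1))‖ = (2 * Real.pi) ^ (n + 1) := norm_two_pi_pow (n + 1)
  rw [h2π] at hy
  have hpos : 0 < (2 * Real.pi) ^ (n + 1) := pow_pos Real.two_pi_pos _
  rw [le_div_iff₀ hpos]
  calc |((y l : ℤ) : ℝ)| ^ m * tau (n + 1) (criticalProbI (n + 1)) 0 y * (2 * Real.pi) ^ (n + 1)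
      = (2 * Real.pi) ^ (n + 1) * tau (n + 1) (criticalProbI (n + 1)) 0 y * |((y l : ℤ) : ℝ)| ^ m := by
        ring
    _ ≤ C := hy

/-- **`|y|^m τ_{p_c}(0,y) ≤ C`** (all coordinates at once: `⟦y⟧ ≤ √d |y_l|` for the largest
coordinate `l`). [cite: Hara2008, Lemma 1.7 and §4.1.1 ((4.3): |x|^α ≤ c_α Σ_j |x_j|^α)] -/
theorem IsLaceCoefficientPc.exists_pow_mul_tau_le {Φ : Site d → ℝ} (h : IsLaceCoefficientPc d Φ)
    {M : ℕ} (hM2 : 2 ≤ M) (hmom : Summable fun x => (1 + euclidNorm x) ^ M * |Φ x|) {m : ℕ}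
    (hm : m ≤ M) (hmd : m + 3 ≤ d) :
    ∃ C : ℝ, ∀ y : Site d, euclidNorm y ^ m * tau d (criticalProbI d) 0 y ≤ C := by
  have hd : 1 ≤ d := by omega
  choose C hC using fun l : Fin d => h.exists_abs_pow_mul_tau_le hM2 hmom hm hmd l
  have hne : (Finset.univ : Finset (Fin d)).Nonempty := ⟨⟨0, by omega⟩, Finset.mem_univ _⟩
  set Cmax : ℝ := Finset.univ.sup' hne C with hCmax
  refine ⟨max 1 (Real.sqrt d ^ m * Cmax), fun y => ?_⟩
  by_cases hy : y = 0
  · subst hy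
    have hτ := tau_le_one (criticalProbI d) (0 : Site d) 0
    have h0 : euclidNorm (0 : Site d) ^ m ≤ 1 := by
      rcases Nat.eq_zero_or_pos m with rfl | hm0
      · simp
      · have : euclidNorm (0 : Site d) = 0 := by simp [euclidNorm]
        rw [this, zero_pow hm0.ne']
        exact zero_le_one
    calc euclidNorm (0 : Site d) ^ m * tau d (criticalProbI d) 0 0 ≤ 1 * 1 :=
          mul_le_mul h0 hτ (tau_nonneg _ _ _) zero_le_one
      _ = 1 := one_mul 1
      _ ≤ _ := le_max_left _ _
  · obtain ⟨l, hl1, hl⟩ := exists_coord_ge hd hy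
    have hτ0 := tau_nonneg (criticalProbI d) 0 y
    have he : euclidNorm y ≤ Real.sqrt d * |((y l : ℤ) : ℝ)| := (euclidNorm_le_jnorm y).trans hl
    have hCl : C l ≤ Cmax := Finset.le_sup' C (Finset.mem_univ l)
    calc euclidNorm y ^ m * tau d (criticalProbI d) 0 y
        ≤ (Real.sqrt d * |((y l : ℤ) : ℝ)|) ^ m * tau d (criticalProbI d) 0 y :=
          mul_le_mul_of_nonneg_right (pow_le_pow_left₀ (euclidNorm_nonneg y) he m) hτ0
      _ = Real.sqrt d ^ m * (|((y l : ℤ) : ℝ)| ^ m * tau d (criticalProbI d) 0 y) := by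
          rw [mul_pow]
          ring
      _ ≤ Real.sqrt d ^ m * Cmax :=
          mul_le_mul_of_nonneg_left ((hC l y).trans hCl) (pow_nonneg (Real.sqrt_nonneg _) m)
      _ ≤ _ := le_max_right _ _

/-- **Hara 2008, Lemma 1.7, the `Ḡ`-clause for integer exponents (and the non-integer ones below
them)**: for a lace-expansion coefficient `Φ = Π_{p_c}` of critical percolation with
`Σ_x (1+|x|)^M |Π(x)| < ∞`, `M ≥ 2`, and a real `α` with `⌈α⌉ ≤ M` and `⌈α⌉ + 3 ≤ d`:
`Ḡ^{(α)} = sup_a |a|^α τ_{p_c}(0,a) < ∞` ("`Ḡ^{(α)} < ∞` if `α ≤ φ` and `α < d - 2`"; Hara's proof of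
this case: §4.1.2 for even `α`, §4.1.3 for non-integer `α < ⌊φ⌋`).
[cite: Hara2008, Lemma 1.7 ((1.30)) and §4.1.2–§4.1.3] -/
theorem IsLaceCoefficientPc.haraGBar_lt_top_of_moment {Φ : Site d → ℝ} (h : IsLaceCoefficientPc d Φ)
    {M : ℕ} (hM2 : 2 ≤ M) (hmom : Summable fun x => (1 + euclidNorm x) ^ M * |Φ x|) {α : ℝ}
    (hαM : ⌈α⌉₊ ≤ M) (hαd : ⌈α⌉₊ + 3 ≤ d) : haraGBar d α < ⊤ := by
  have hd : 1 ≤ d := by omega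
  obtain ⟨C, hC⟩ := h.exists_pow_mul_tau_le hM2 hmom hαM hαd
  refine haraGBar_lt_top_of_le (C := max 1 C) fun y => ?_
  unfold haraG
  have hτ0 := tau_nonneg (criticalProbI d) 0 y
  have hτ1 := tau_le_one (criticalProbI d) 0 y
  by_cases hy : y = 0
  · subst hy
    have h0 : euclidNorm (0 : Site d) ^ α ≤ 1 := by
      have : euclidNorm (0 : Site d) = 0 := by simp [euclidNorm]
      rw [this]
      exact Real.zero_rpow_le_one α
    calc euclidNorm (0 : Site d) ^ α * tau d (criticalProbI d) 0 0 ≤ 1 * 1 :=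
          mul_le_mul h0 hτ1 hτ0 zero_le_one
      _ = 1 := one_mul 1
      _ ≤ _ := le_max_left _ _
  · obtain ⟨l, hl1, -⟩ := exists_coord_ge hd hy
    have h1 : 1 ≤ euclidNorm y := hl1.trans (abs_apply_le_euclidNorm y l)
    have hpow : euclidNorm y ^ α ≤ euclidNorm y ^ ⌈α⌉₊ := by
      rw [← Real.rpow_natCast]
      exact Real.rpow_le_rpow_of_exponent_le h1 (Nat.le_ceil α)
    calc euclidNorm y ^ α * tau d (criticalProbI d) 0 y
        ≤ euclidNorm y ^ ⌈α⌉₊ * tau d (criticalProbI d) 0 y := mul_le_mul_of_nonneg_right hpow hτ0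
      _ ≤ C := hC y
      _ ≤ _ := le_max_right _ _

/-- The same from the hypotheses of Lemma 1.7 as vendored (`Σ_x |x|^φ |Π(x)| < ∞`), for `φ ≥ 2`:
**`Ḡ^{(α)} < ∞` for every real `α` with `⌈α⌉ ≤ ⌊φ⌋` and `⌈α⌉ + 3 ≤ d`** — the integer (even or odd)
and sub-`⌊φ⌋` cases of the `Ḡ`-clause of `Hara2008_lemma17Pc`.
[cite: Hara2008, Lemma 1.7 ((1.30)) and §4.1.2–§4.1.3] -/
theorem IsLaceCoefficientPc.haraGBar_lt_top_of_rpow {Φ : Site d → ℝ} (h : IsLaceCoefficientPc d Φ)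
    {φ : ℝ} (hφ2 : 2 ≤ φ) (hmom : Summable fun x => euclidNorm x ^ φ * |Φ x|) {α : ℝ}
    (hαφ : ⌈α⌉₊ ≤ ⌊φ⌋₊) (hαd : ⌈α⌉₊ + 3 ≤ d) : haraGBar d α < ⊤ := by
  have hM : Summable fun x => (1 + euclidNorm x) ^ ⌊φ⌋₊ * |Φ x| :=
    summable_one_add_pow_mul_abs_of_rpow (Nat.floor_le (by linarith)) h.summable_abs hmom
  have h2 : 2 ≤ ⌊φ⌋₊ := Nat.le_floor (by exact_mod_cast hφ2)
  exact h.haraGBar_lt_top_of_moment h2 hM hαφ hαd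

end Literature.Barriers.CriticalPhenomena
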